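import Summits.CriticalPhenomena.CardyFormulaZ2.Theses.CardyMeckeFlip
import Literature.Probability.Percolation.FlipFairKernel
import Literature.Probability.Percolation.Z2PivotalMeasure

/-!
# Restatement candidates for crux `MeckeRigidity` (stmt-CriticalPhenomena-14826) — lead c5 evidence, NOT a tree file

Supersedes lead c4's `MeckeRigidityRestated.lean` (crux dir), whose kernel clause (CAN) is typed over the set
`pivotalSetAtScale S ε = {x | ∃ Q, ε ≤ diam [Q] ∧ S.IsPivotalAt x Q}` ("pivotal for SOME quad of diameter ≥ ε").
That set is the wrong one: pivotality for a quad of large DIAMETER does not force long arms — a point with four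
alternating arms to an arbitrarily small distance `w` is pivotal for a quad of size `w` around it to which a thin
tentacle of diameter `ε` has been attached away from the landing sides — so for a percolation-like configuration
`pivotalSetAtScale S ε` contains every microscopic four-arm point and is a.s. DENSE in the plane; its
`r`-thickenings are the whole plane, c4's (CAN) then forces `M ε S = c · Leb`, and (ADM)(4) (support on the
Lebesgue-null pivotal set) + (ADM)(5) (non-zero) contradict it: c4's K2-R1 is vacuous for the intended model class
and its K3-R1 is false.  The notion the source uses is ε-IMPORTANCE (Garban–Pete–Schramm, JEMS 2018 §2.6 /
JAMS 2013 §1.1: four alternating arms from `x` to distance `ε`), whose quad-crossing rendering is "pivotal for a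
quad whose carrier contains the closed `ε`-ball about `x`" (`importantPoints` below): an open crossing through `x`
gives the two open arms to `∂[Q] ⊇ ∂B(x, ε)`-far sides, the absence of crossings avoiding small balls about `x`
gives the two dual arms; conversely GPS's `A_Q`-important points of the `ε`-grid are important in this sense at a
comparable scale (take for `Q` the `3ε`-square with its four sides cut at the alternating landing points).  This set
IS sparse (a subset of the scale-`ε` four-arm points; box-counting dimension `3/4` for CLE₆) and its normalised
thickenings converge to the GPS pivotal measure `μ^ε` [GPS 2013 §4 (counting mesoscopic boxes with the four-arm
event — the measurability proof), Holden–Li–Sun arXiv:1804.07286 Prop. 1.9 / Thm 1.10 (Minkowski content)].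

Two typed repairs of the crux's free kernel quantifier are offered (both elaborate; both are WEAKER than the typed
crux, so the 29 `--supports` files of the item and the registered skeleton `Lines/birth.lean` transfer verbatim):

* **R1a (axiomatic, intrinsic) `MeckeRigidityImportance`** = the typed crux + (CAN′) `IsImportanceContentKernel`:
  for every cutoff `ε > 0` there are deterministic radii `r k → 0` and normalisers `c k > 0` with
  `c k · Leb|_{(importantPoints S ε)^{r k}} → M ε S` vaguely for `P`-a.e. `S`.  State-blind by construction, so the
  `q^{σ/4}`-TILTED FK(q) kernels of the refuters' objection (rattack-14452-0 / rattack-13855-0, 2026-08-15) violate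
  (CAN′), while the UNtilted content kernel of FK(q), `q ≠ 1`, violates (F) (lattice defect ≠ 0, certificates
  flipcheck.py / fk_flip_check.py on the item) — (F) regains its fair-coin content.  Honest status: open problem
  (isotropic self-dual flip-ergodic crossing universality), no longer conjecturally false.
* **R1b (lattice-canonical, this route's own object) `MeckeRigidityZ2Canonical`**: quantify over ℤ² subsequential
  limits `μ ∈ Λ` and kernels `M` with `IsZ2PivotalKernelLimit μ M` (tree, `Z2PivotalMeasure.lean`: `M` is the joint
  subsequential limit of GPS's isometry-averaged, `π₄`-normalised, EQUAL-WEIGHT counting measures on ε-important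
  edges — exactly the refuters' repair "K1's `δ²/π₄`-normalised COUNT").  FK(q) is not a bond-ℤ²-percolation
  sublimit, so the objection does not even type-check against R1b.  Honest status: open problem (= Cardy universality
  for bond-ℤ² GIVEN isotropy, exact duality, RSW and flip-ergodicity of the sublimit w.r.t. its GPS kernel).  Typing
  caveat for the planner: `Z2PivotalMeasure` imports `QuadCrossingSpaceZ2`, i.e. the cone carrying
  `dkkmo_crossing_rotation_invariance` that rev 2 of the route removed from `LatticeFlipIdentity`; a route file using
  R1b must either accept that cone or re-home `z2PivotalMeasure` over `configOf` as rev 2 did.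

For each: the restated K3 that must be co-filed, the glue `K2′ → K3′ → Z2LimitsSymmetric → SublimitsCardy` (the
deciding theorem keeps its shape), and `MeckeRigidity → K2′`.  This file files nothing; restating is the planner's.
-/

noncomputable section

open MeasureTheory Set Filter Topology
open Literature.Probability.Percolation Literature.Probability.Percolation.QuadCrossing

namespace Summit.CriticalPhenomena.CardyFormulaZ2.Cruxes.MeckeRigidity.RestatedC5

/-! ### ε-important points and the content kernel (R1a) -/

/-- The **ε-important points** of a configuration `S ∈ ℋ_ℂ`: the points pivotal — open- or closed-pivotal,
indifferently — for some quad whose carrier contains the closed `ε`-ball about the point (so that pivotality forces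
four alternating arms from the point to distance `ε`; the quad-crossing rendering of Garban–Pete–Schramm's
`ε`-important points). [cite: GarbanPeteSchramm2018, §2.6 (A-important and ε-important points); GarbanPeteSchramm2013Pivotal, §1.1] -/
def importantPoints (S : QuadConfig (univ : Set ℂ)) (ε : ℝ) : Set ℂ :=
  {x | ∃ Q : Quad (univ : Set ℂ), Metric.closedBall x ε ⊆ Q.carrier ∧ S.IsPivotalAt x Q}

/-- Important points are pivotal points (so a kernel living on them meets the support clause (ADM)(4)). [folklore] -/
theorem importantPoints_subset_pivotalPoints (S : QuadConfig (univ : Set ℂ)) (ε : ℝ) :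
    importantPoints S ε ⊆ S.pivotalPoints :=
  fun _ ⟨Q, _, hQ⟩ => ⟨Q, hQ⟩

/-- Importance is antitone in the scale: `ε' ≤ ε` gives `importantPoints S ε ⊆ importantPoints S ε'` (lowering the
cutoff only adds points, matching the antitone clause (ADM)(2)). [folklore] -/
theorem importantPoints_antitone (S : QuadConfig (univ : Set ℂ)) {ε ε' : ℝ} (h : ε' ≤ ε) :
    importantPoints S ε ⊆ importantPoints S ε' :=
  fun _ ⟨Q, hball, hQ⟩ => ⟨Q, (Metric.closedBall_subset_closedBall h).trans hball, hQ⟩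

/-- An important point lies in the carrier of its quad together with its closed `ε`-ball; in particular
`0 ≤ ε → x ∈ [Q]`. [folklore] -/
theorem mem_carrier_of_mem_importantPoints {S : QuadConfig (univ : Set ℂ)} {ε : ℝ} (hε : 0 ≤ ε) {x : ℂ}
    (hx : x ∈ importantPoints S ε) : ∃ Q : Quad (univ : Set ℂ), x ∈ Q.carrier ∧ S.IsPivotalAt x Q := by
  obtain ⟨Q, hball, hQ⟩ := hx
  exact ⟨Q, hball (Metric.mem_closedBall_self hε), hQ⟩

/-- **(CAN′) — canonical equal-weight (importance-content) kernel**: for every cutoff `ε > 0` there are deterministic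
radii `r k → 0` and deterministic normalisers `c k > 0` such that, for `P`-a.e. configuration `S`, the measures
`c k · Leb|_{(importantPoints S ε)^{r k}}` converge vaguely to `M ε S`.  For the CLE₆ quad-crossing law this is the
box-counting / Minkowski-content description of the Garban–Pete–Schramm pivotal measure `μ^ε` (normaliser
`c k ≍ α₄(r k, ε)⁻¹`); the normalisers are existential so that no arm exponent is presupposed (ℤ² sublimits).
[cite: GarbanPeteSchramm2013Pivotal, §4 (mesoscopic box counts, measurability of the limit measure); arXiv:1804.07286, Prop. 1.9 and Thm 1.10] -/
def IsImportanceContentKernel (P : Measure (QuadConfig (univ : Set ℂ)))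
    (M : ℝ → QuadConfig (univ : Set ℂ) → Measure ℂ) : Prop :=
  ∀ ε : ℝ, 0 < ε → ∃ (r c : ℕ → ℝ), (∀ k, 0 < r k) ∧ (∀ k, 0 < c k) ∧ Tendsto r atTop (𝓝 0) ∧
    ∀ᵐ S ∂P, ∀ φ : ℂ → ℝ, Continuous φ → HasCompactSupport φ →
      Tendsto (fun k => c k * ∫ x in Metric.thickening (r k) (importantPoints S ε), φ x)
        atTop (𝓝 (∫ x, φ x ∂(M ε S)))

/-- **K2-R1a `MeckeRigidityImportance`** — MECKE RIGIDITY FOR THE IMPORTANCE-CONTENT KERNEL: a probability law `P` on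
`ℋ_ℂ` with (E2) isometry invariance, (D) exact self-duality on crossing cylinders, (RSW) the 3:1 lower bound,
carrying a kernel family `M` that is admissible and isometry-equivariant (ADM), CANONICAL in the sense of (CAN′)
(`IsImportanceContentKernel`), flip-fair at every cutoff (F) and for which `P` is flip-extremal (EXT), gives every
quad of a conformal rectangle its Cardy value. [cite: GarbanPeteSchramm2018, Thm 89 (reversibility) and Remark 101; arXiv:1905.06940, Thm 1.4 (i) (mixing); GarbanPeteSchramm2013Pivotal, Thm 1.1] -/
def MeckeRigidityImportance : Prop :=
  ∀ (P : Measure (QuadConfig (univ : Set ℂ))) (M : ℝ → QuadConfig (univ : Set ℂ) → Measure ℂ),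
    IsProbabilityMeasure P →
    (∀ g : ℂ ≃ᵢ ℂ, Measure.map (QuadConfig.isometry g) P = P) →
    (∀ (n : ℕ) (Q Qt : Fin n → Quad (univ : Set ℂ)),
      (∀ i, (Qt i).carrier = (Q i).carrier ∧ (Qt i).side 0 = (Q i).side 1 ∧
        (Qt i).side 1 = (Q i).side 2 ∧ (Qt i).side 2 = (Q i).side 3 ∧ (Qt i).side 3 = (Q i).side 0) →
      ∀ A : Set (Set (Fin n)), P {S | {i | Q i ∈ S} ∈ A} = P {S | {i | Qt i ∉ S} ∈ A}) →
    ∀ c : ℝ, 0 < c →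
    (∀ (a x y : ℝ), 0 < a → ∀ Q : Quad (univ : Set ℂ),
      Q.carrier = {w : ℂ | x ≤ w.re ∧ w.re ≤ x + 3 * a ∧ y ≤ w.im ∧ w.im ≤ y + a} →
      Q.side 0 = {w : ℂ | w.re = x ∧ y ≤ w.im ∧ w.im ≤ y + a} →
      Q.side 2 = {w : ℂ | w.re = x + 3 * a ∧ y ≤ w.im ∧ w.im ≤ y + a} →
        c ≤ P.real (QuadConfig.crossedEvent Q)) →
    IsAdmissibleKernel P M → IsIsometryEquivariant M → IsImportanceContentKernel P M →
    (∀ ε : ℝ, 0 < ε → IsFlipFairKernel P (M ε)) → IsFlipExtremal P M →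
    ∀ (R : Literature.Probability.RandomPlanarGeometry.ConformalRectangle)
      (φ : Literature.Probability.RandomPlanarGeometry.ConformalEquiv UpperHalfPlane.upperHalfPlaneSet R.carrier)
      (x : Fin 4 → ℝ), R.IsUniformizing φ x → ∀ Q : Quad (univ : Set ℂ),
        Q.carrier = closure R.carrier → Q.side 0 = R.arc 0 → Q.side 1 = R.arc 1 → Q.side 2 = R.arc 2 →
        Q.side 3 = R.arc 3 →
          P.real (QuadConfig.crossedEvent Q) =
            Literature.Probability.RandomPlanarGeometry.cardyFunction
              (Literature.Probability.RandomPlanarGeometry.crossRatio x)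

/-- **K2-R1a is weaker than the typed crux**: `MeckeRigidity → MeckeRigidityImportance` (instantiate `Piv` at
`IsPivotalAt` by `Iff.rfl`, unbundle the named clauses, drop (CAN′)); hence every `--supports` file of the typed
crux serves K2-R1a verbatim. [folklore] -/
theorem meckeRigidityImportance_of_meckeRigidity
    (h : Summit.CriticalPhenomena.CardyFormulaZ2.Theses.CardyMeckeFlip.MeckeRigidity) :
    MeckeRigidityImportance := by
  intro P M hprob hE2 hD c hc hRSW hADM hEqv _hCAN hF hEXT R φ x hφx Q hQc h0 h1 h2 h3
  have hAE := (isAdmissibleKernel_and_isIsometryEquivariant_iff P M).1 ⟨hADM, hEqv⟩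
  exact h _ (fun _ _ _ => Iff.rfl) P M hprob hE2 hD c hc hRSW hAE hF hEXT R φ x hφx Q hQc h0 h1 h2 h3

/-- **K3-R1a `FlipErgodicityZ2Importance`** — the companion restatement of crux `FlipErgodicityZ2`
(stmt-CriticalPhenomena-14825) that a route using K2-R1a must file: every ℤ² subsequential quad-crossing limit
carries an admissible, isometry-equivariant, importance-content ((CAN′)) kernel family, flip-fair at every cutoff,
for which it is flip-extremal.  (Intended witness: the subsequential limit of GPS's normalised counting measures,
identified with the box-counting content of the ε-important set — GPS 2013 §1 p. 10 / §4 level.) [cite: GarbanPeteSchramm2013Pivotal, §1 p. 10 and §4; arXiv:1905.06940, Thm 1.4 (i)] -/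
def FlipErgodicityZ2Importance : Prop :=
  ∀ μ : FiniteMeasure (QuadConfig (univ : Set ℂ)), μ ∈ subseqQuadLimits (univ : Set ℂ) →
    ∃ M : ℝ → QuadConfig (univ : Set ℂ) → Measure ℂ,
      IsAdmissibleKernel (μ : Measure (QuadConfig (univ : Set ℂ))) M ∧ IsIsometryEquivariant M ∧
      IsImportanceContentKernel (μ : Measure (QuadConfig (univ : Set ℂ))) M ∧
      (∀ ε : ℝ, 0 < ε → IsFlipFairKernel (μ : Measure (QuadConfig (univ : Set ℂ))) (M ε)) ∧
      IsFlipExtremal (μ : Measure (QuadConfig (univ : Set ℂ))) M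

/-- **The R1a glue chains**: `MeckeRigidityImportance → FlipErgodicityZ2Importance → Z2LimitsSymmetric →
SublimitsCardy` (the analogue of the route's `CruxesToSublimitsCardy` / first `have` of `closes`). [folklore] -/
theorem sublimitsCardy_of_importance (hK2 : MeckeRigidityImportance) (hK3 : FlipErgodicityZ2Importance)
    (hS : Summit.CriticalPhenomena.CardyFormulaZ2.Theses.CardyMeckeFlip.Z2LimitsSymmetric) :
    Summit.CriticalPhenomena.CardyFormulaZ2.Theses.CardyMeckeFlip.SublimitsCardy := by
  intro μ hμ R φ x hφx Q hQc h0 h1 h2 h3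
  obtain ⟨hprob, hsym, hdual, c, hc, hrsw⟩ := hS μ hμ
  obtain ⟨M, hADM, hEqv, hCAN, hF, hEXT⟩ := hK3 μ hμ
  exact hK2 _ M hprob hsym hdual c hc hrsw hADM hEqv hCAN hF hEXT R φ x hφx Q hQc h0 h1 h2 h3

/-! ### The lattice-canonical kernel (R1b) -/

/-- **K2-R1b `MeckeRigidityZ2Canonical`** — MECKE RIGIDITY FOR ℤ² SUBLIMITS WITH THEIR GARBAN–PETE–SCHRAMM KERNEL:
for every subsequential quad-crossing scaling limit `μ` of bond-ℤ² percolation at `p = ½` and every kernel family `M`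
that is the joint subsequential limit of GPS's isometry-averaged, `π₄`-normalised, equal-weight counting measures on
ε-important edges (`IsZ2PivotalKernelLimit μ M`), the clauses (E2), (D), (RSW), (ADM)+equivariance, (F) and (EXT)
imply the Cardy values on every quad of a conformal rectangle.  (The refuters' repair R1 "pin `M` to K1's normalised
COUNT": a tilted kernel is not such a limit, and FK(q) is not a bond-ℤ² sublimit.) [cite: GarbanPeteSchramm2013Pivotal, §1 p. 10 and §4.1; GarbanPeteSchramm2018, §2.6 and Thm 89; SchrammSmirnov2011, Cor. 1.6] -/
def MeckeRigidityZ2Canonical : Prop :=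
  ∀ μ : FiniteMeasure (QuadConfig (univ : Set ℂ)), μ ∈ subseqQuadLimits (univ : Set ℂ) →
    ∀ M : ℝ → QuadConfig (univ : Set ℂ) → Measure ℂ, IsZ2PivotalKernelLimit μ M →
    IsProbabilityMeasure (μ : Measure (QuadConfig (univ : Set ℂ))) →
    (∀ g : ℂ ≃ᵢ ℂ, Measure.map (QuadConfig.isometry g) (μ : Measure (QuadConfig (univ : Set ℂ))) =
      (μ : Measure (QuadConfig (univ : Set ℂ)))) →
    (∀ (n : ℕ) (Q Qt : Fin n → Quad (univ : Set ℂ)),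
      (∀ i, (Qt i).carrier = (Q i).carrier ∧ (Qt i).side 0 = (Q i).side 1 ∧
        (Qt i).side 1 = (Q i).side 2 ∧ (Qt i).side 2 = (Q i).side 3 ∧ (Qt i).side 3 = (Q i).side 0) →
      ∀ A : Set (Set (Fin n)), (μ : Measure (QuadConfig (univ : Set ℂ))) {S | {i | Q i ∈ S} ∈ A} =
        (μ : Measure (QuadConfig (univ : Set ℂ))) {S | {i | Qt i ∉ S} ∈ A}) →
    ∀ c : ℝ, 0 < c →
    (∀ (a x y : ℝ), 0 < a → ∀ Q : Quad (univ : Set ℂ),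
      Q.carrier = {w : ℂ | x ≤ w.re ∧ w.re ≤ x + 3 * a ∧ y ≤ w.im ∧ w.im ≤ y + a} →
      Q.side 0 = {w : ℂ | w.re = x ∧ y ≤ w.im ∧ w.im ≤ y + a} →
      Q.side 2 = {w : ℂ | w.re = x + 3 * a ∧ y ≤ w.im ∧ w.im ≤ y + a} →
        c ≤ (μ : Measure (QuadConfig (univ : Set ℂ))).real (QuadConfig.crossedEvent Q)) →
    IsAdmissibleKernel (μ : Measure (QuadConfig (univ : Set ℂ))) M → IsIsometryEquivariant M →
    (∀ ε : ℝ, 0 < ε → IsFlipFairKernel (μ : Measure (QuadConfig (univ : Set ℂ))) (M ε)) →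
    IsFlipExtremal (μ : Measure (QuadConfig (univ : Set ℂ))) M →
    ∀ (R : Literature.Probability.RandomPlanarGeometry.ConformalRectangle)
      (φ : Literature.Probability.RandomPlanarGeometry.ConformalEquiv UpperHalfPlane.upperHalfPlaneSet R.carrier)
      (x : Fin 4 → ℝ), R.IsUniformizing φ x → ∀ Q : Quad (univ : Set ℂ),
        Q.carrier = closure R.carrier → Q.side 0 = R.arc 0 → Q.side 1 = R.arc 1 → Q.side 2 = R.arc 2 →
        Q.side 3 = R.arc 3 →
          (μ : Measure (QuadConfig (univ : Set ℂ))).real (QuadConfig.crossedEvent Q) =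
            Literature.Probability.RandomPlanarGeometry.cardyFunction
              (Literature.Probability.RandomPlanarGeometry.crossRatio x)

/-- **K2-R1b is weaker than the typed crux**: `MeckeRigidity → MeckeRigidityZ2Canonical` (specialise the law to a
ℤ² sublimit and the kernel to a GPS kernel limit, then as for R1a). [folklore] -/
theorem meckeRigidityZ2Canonical_of_meckeRigidity
    (h : Summit.CriticalPhenomena.CardyFormulaZ2.Theses.CardyMeckeFlip.MeckeRigidity) :
    MeckeRigidityZ2Canonical := by
  intro μ _hμ M _hlim hprob hE2 hD c hc hRSW hADM hEqv hF hEXT R φ x hφx Q hQc h0 h1 h2 h3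
  have hAE := (isAdmissibleKernel_and_isIsometryEquivariant_iff (μ : Measure (QuadConfig (univ : Set ℂ))) M).1
    ⟨hADM, hEqv⟩
  exact h _ (fun _ _ _ => Iff.rfl) _ M hprob hE2 hD c hc hRSW hAE hF hEXT R φ x hφx Q hQc h0 h1 h2 h3

/-- **K3-R1b `FlipErgodicityZ2Lattice`** — the companion restatement of crux `FlipErgodicityZ2` for R1b: every ℤ²
subsequential quad-crossing limit carries a kernel family that IS a joint subsequential limit of the GPS lattice
kernels (`IsZ2PivotalKernelLimit`, along a mesh sequence realising the limit), admissible, isometry-equivariant,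
flip-fair at every cutoff, and for which the limit law is flip-extremal.  (= the typed K3 with the kernel pinned to
K1's intended witness; K1 `FlipIdentityZ2` should be pinned the same way.) [cite: GarbanPeteSchramm2013Pivotal, §1 p. 10 and §4.1; GarbanPeteSchramm2018, §2.6 Cor. and Thm 89; arXiv:1905.06940, Thm 1.4 (i)] -/
def FlipErgodicityZ2Lattice : Prop :=
  ∀ μ : FiniteMeasure (QuadConfig (univ : Set ℂ)), μ ∈ subseqQuadLimits (univ : Set ℂ) →
    ∃ M : ℝ → QuadConfig (univ : Set ℂ) → Measure ℂ, IsZ2PivotalKernelLimit μ M ∧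
      IsAdmissibleKernel (μ : Measure (QuadConfig (univ : Set ℂ))) M ∧ IsIsometryEquivariant M ∧
      (∀ ε : ℝ, 0 < ε → IsFlipFairKernel (μ : Measure (QuadConfig (univ : Set ℂ))) (M ε)) ∧
      IsFlipExtremal (μ : Measure (QuadConfig (univ : Set ℂ))) M

/-- **The R1b glue chains**: `MeckeRigidityZ2Canonical → FlipErgodicityZ2Lattice → Z2LimitsSymmetric →
SublimitsCardy`. [folklore] -/
theorem sublimitsCardy_of_z2Canonical (hK2 : MeckeRigidityZ2Canonical) (hK3 : FlipErgodicityZ2Lattice)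
    (hS : Summit.CriticalPhenomena.CardyFormulaZ2.Theses.CardyMeckeFlip.Z2LimitsSymmetric) :
    Summit.CriticalPhenomena.CardyFormulaZ2.Theses.CardyMeckeFlip.SublimitsCardy := by
  intro μ hμ R φ x hφx Q hQc h0 h1 h2 h3
  obtain ⟨hprob, hsym, hdual, c, hc, hrsw⟩ := hS μ hμ
  obtain ⟨M, hlim, hADM, hEqv, hF, hEXT⟩ := hK3 μ hμ
  exact hK2 μ hμ M hlim hprob hsym hdual c hc hrsw hADM hEqv hF hEXT R φ x hφx Q hQc h0 h1 h2 h3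

end Summit.CriticalPhenomena.CardyFormulaZ2.Cruxes.MeckeRigidity.RestatedC5

end
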